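import Summits.BirchSwinnertonDyer.BirchSwinnertonDyer.Theorems.PrintCFramBottomClassIndexLawFiveLeCuspSeedQExpansionPrincipleAtZero
import Summits.BirchSwinnertonDyer.BirchSwinnertonDyer.Theorems.PrintCFramBottomClassIndexLawFiveLeThetaQExpansion
import Summits.BirchSwinnertonDyer.BirchSwinnertonDyer.Theorems.PrintCFramBottomClassIndexLawFiveLeCuspSeedVehicle
import HarnessLib

set_option autoImplicit false

/-!
# Crux `PrintCFram.BottomClassIndexLawFiveLe` (stmt-BirchSwinnertonDyer-20372), line `eisenstein-resource-bdp-line` (registry v27,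
# `stub_flipRung`): T4 — KATZ's q-EXPANSION PRINCIPLE TRANSPORTED TO EVERY COEFFICIENT AT EVERY CUSP, AND THROUGH A θ-TYPE FACTOR
# (cell `bsd-print-cfram`, width seat `bsd-line-cfram-p1-w3` g19; THEOREMS ONLY, `--supports` 20372; BSD is not proved by any of this)

HONEST FRAMING. Nothing here is a statement about elliptic curves or BSD; no registered stub is closed. Registry v27's `stub_flipRung`
(LEAD g14, `…FlipRungSupply`, p706253: THE FLIPPED-CUSP RUNG in Bernoulli currency) is PRINT-DERIVABLE; its typing was cut into pieces
T1–T6 (HOME/STATUS 2026-08-29T07:30:58Z). This file is **T4, the NF-Q transport**: the generic plumbing that carries «every coefficient at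
`∞` lies in `d·ℤ̄[1/N]`» (i) to EVERY coefficient of the expansion of `F ∣_k γ` at `∞` for EVERY `γ ∈ SL₂(ℤ)` (the named fact
`Katz1973_qExpansionPrinciple_allCusps`, NF-Q, read through the restriction `Γ(N) ≤ Γ₁(L)` and the `1`-periodic ↔ `N`-periodic coefficient
dictionary of (γ) `…CuspSeedQExpansionPrincipleAtZero` §§1–2), and (ii) THROUGH A FACTORISATION `F ∣_k γ = Θ · B` on `ℍ` in which the
`N`-expansion of `Θ` has coefficients in `ℤ̄[1/N]` and a UNIT constant term (the shape T3 delivers at the flipped cusp `γ∞ = (a b; M q⁴)`: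
`Θ` = the theta power of the vehicle, `B` = the translate bracket): then every coefficient of the `N`-expansion of `B` lies in `d·ℤ̄[1/N]`
(power-series division by a unit of `ℤ̄[1/N]⟦q⟧`, §2). §5 is the integrality transfer in the LINEAR shape the rung meets («a rational Cohen
number × an integer prime to `p` × a unit of `ℤ̄[1/N]` lies in `p·ℤ̄[1/N]` ⟹ `v_p ≥ 1`», from (γ) §5 `ℚ ∩ ℤ̄ = ℤ`) with the mod-`p` reading
«`ι x = 0`» of (γ) §6. Membership `y ∈ ℤ̄[1/N]` is spelled `∃ j, IsIntegral ℤ (N^j · y)` throughout (as in NF-Q); no definitions.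

* §1 closure of `ℤ̄[1/N]` and `d·ℤ̄[1/N]` under ring operations (addition/sums: (δ) `CuspGlue.exists_isIntegral_pow_mul_add/_sum`, reused); §2 `forall_coeff_of_eq_mul_of_unit` (division of `A = T·B` by a `T` with
  coefficients in `ℤ̄[1/N]` and unit constant term keeps `d·ℤ̄[1/N]`-coefficients; strong induction on the Cauchy product) and `forall_coeff_mul`;
* §3 `exists_isIntegral_qExpansion_slash_coeff` — NF-Q at every coefficient of `qExpansion N (F ∣_k γ)` for `F : ModularForm (Gamma1 L) k`,
  `L ∣ N`, `3 ≤ N`, `γ ∈ SL₂(ℤ)` ((γ) §4 was `n = 0`); §4 `exists_isIntegral_qExpansion_coeff_of_slash_eq_mul` — the transport through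
  `F ∣_k γ = Θ · B`, with dilation helpers feeding the `Θ`-hypotheses from the `1`-periodic expansion; §5 the linear integrality transfer
  `le_padicValRat_of_mul_mul_eq_pow_mul` and its mod-`p` reading; §6 the `Θ`-hypotheses DISCHARGED for `θ(Q²·)^p` and the packaged
  transport `exists_isIntegral_qExpansion_coeff_of_slash_eq_thetaMul_pow_mul`.

No new definitions, no named facts, no `sorry`. beyond-print theorem: NO (Katz 1973 Cor. 1.6.2 bookkeeping). BSD is not proved by any of
this; no summit statement is proved by this seat; no registered stub is closed by this file.

References: [Katz1973] §1.6 Cor. 1.6.2, §1.2, §1.7; [DiamondShurman2005] §1.1–1.2; crux notes `Lines/eisenstein-resource-bdp-line-lead-g14.md` §2.1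
(MOD-p COROLLARY: «q-expansion principle at the cusp `W_Q(∞)` … transports ≡ 0 at `∞` to ≡ 0 at `W_Q(∞)`»).
-/

-- summit-side namespace `Summit.BirchSwinnertonDyer.BirchSwinnertonDyer.…` (single-conjunct summit, D-0017 layout)
set_option linter.dupNamespace false

noncomputable section

namespace Summit.BirchSwinnertonDyer.BirchSwinnertonDyer.Theorems.PrintCFram.FlipRung

open UpperHalfPlane Filter Function Complex CongruenceSubgroup PowerSeries
open scoped MatrixGroups ModularForm Topology Manifold Real
open Summit.BirchSwinnertonDyer.BirchSwinnertonDyer.Theorems.PrintCFram.CuspGlue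

/-! ## §1 Closure properties of `ℤ̄[1/N] = {y : ∃ j, N^j·y integral}` and of `d·ℤ̄[1/N]` -/

/-- Algebraic integers lie in `ℤ̄[1/N]` (`j = 0`). [folklore] -/
theorem exists_isIntegral_pow_mul_of_isIntegral {N : ℕ} {y : ℂ} (hy : IsIntegral ℤ y) :
    ∃ j : ℕ, IsIntegral ℤ ((N : ℂ) ^ j * y) :=
  ⟨0, by simpa using hy⟩

/-- Integers lie in `ℤ̄[1/N]`. [folklore] -/
theorem exists_isIntegral_pow_mul_intCast {N : ℕ} (a : ℤ) : ∃ j : ℕ, IsIntegral ℤ ((N : ℂ) ^ j * (a : ℂ)) :=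
  exists_isIntegral_pow_mul_of_isIntegral (isIntegral_intCast a)

/-- Natural numbers lie in `ℤ̄[1/N]`. [folklore] -/
theorem exists_isIntegral_pow_mul_natCast {N : ℕ} (a : ℕ) : ∃ j : ℕ, IsIntegral ℤ ((N : ℂ) ^ j * (a : ℂ)) :=
  exists_isIntegral_pow_mul_of_isIntegral (isIntegral_natCast a)

/-- `0 ∈ ℤ̄[1/N]`. [folklore] -/
theorem exists_isIntegral_pow_mul_zero {N : ℕ} : ∃ j : ℕ, IsIntegral ℤ ((N : ℂ) ^ j * (0 : ℂ)) :=
  ⟨0, by simpa using isIntegral_zero⟩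

/-- `1/N ∈ ℤ̄[1/N]` (for `N = 0` the inverse is `0`). [folklore] -/
theorem exists_isIntegral_pow_mul_inv_natCast {N : ℕ} : ∃ j : ℕ, IsIntegral ℤ ((N : ℂ) ^ j * (N : ℂ)⁻¹) := by
  rcases eq_or_ne N 0 with rfl | hN
  · exact ⟨0, by simpa using isIntegral_zero⟩
  · refine ⟨1, ?_⟩
    rw [pow_one, mul_inv_cancel₀ (by exact_mod_cast hN)]
    exact isIntegral_one

/-- Raising the exponent: if `N^j·y` is integral then so is `N^(j+i)·y`. [folklore] -/
theorem isIntegral_pow_add_mul {N : ℕ} {y : ℂ} {j : ℕ} (hy : IsIntegral ℤ ((N : ℂ) ^ j * y)) (i : ℕ) :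
    IsIntegral ℤ ((N : ℂ) ^ (j + i) * y) := by
  have : (N : ℂ) ^ (j + i) * y = (N : ℂ) ^ i * ((N : ℂ) ^ j * y) := by ring
  rw [this]
  exact ((isIntegral_natCast (B := ℂ) N).pow i).mul hy

/-- `ℤ̄[1/N]` is closed under multiplication. [folklore] -/
theorem exists_isIntegral_pow_mul_mul {N : ℕ} {x y : ℂ} (hx : ∃ j : ℕ, IsIntegral ℤ ((N : ℂ) ^ j * x))
    (hy : ∃ j : ℕ, IsIntegral ℤ ((N : ℂ) ^ j * y)) : ∃ j : ℕ, IsIntegral ℤ ((N : ℂ) ^ j * (x * y)) := by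
  obtain ⟨i, hi⟩ := hx
  obtain ⟨j, hj⟩ := hy
  refine ⟨i + j, ?_⟩
  have : (N : ℂ) ^ (i + j) * (x * y) = ((N : ℂ) ^ i * x) * ((N : ℂ) ^ j * y) := by ring
  rw [this]
  exact hi.mul hj

/-- `ℤ̄[1/N]` is closed under negation. [folklore] -/
theorem exists_isIntegral_pow_mul_neg {N : ℕ} {x : ℂ} (hx : ∃ j : ℕ, IsIntegral ℤ ((N : ℂ) ^ j * x)) :
    ∃ j : ℕ, IsIntegral ℤ ((N : ℂ) ^ j * (-x)) := by
  obtain ⟨i, hi⟩ := hx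
  exact ⟨i, by rw [mul_neg]; exact hi.neg⟩

/-- `ℤ̄[1/N]` is closed under subtraction. [folklore] -/
theorem exists_isIntegral_pow_mul_sub {N : ℕ} {x y : ℂ} (hx : ∃ j : ℕ, IsIntegral ℤ ((N : ℂ) ^ j * x))
    (hy : ∃ j : ℕ, IsIntegral ℤ ((N : ℂ) ^ j * y)) : ∃ j : ℕ, IsIntegral ℤ ((N : ℂ) ^ j * (x - y)) := by
  rw [sub_eq_add_neg]
  exact exists_isIntegral_pow_mul_add hx (exists_isIntegral_pow_mul_neg hy)

/-- `d·ℤ̄[1/N]` is closed under addition. [folklore] -/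
theorem exists_eq_natCast_mul_add {N d : ℕ} {x y : ℂ}
    (hx : ∃ u : ℂ, (∃ j : ℕ, IsIntegral ℤ ((N : ℂ) ^ j * u)) ∧ x = (d : ℂ) * u)
    (hy : ∃ u : ℂ, (∃ j : ℕ, IsIntegral ℤ ((N : ℂ) ^ j * u)) ∧ y = (d : ℂ) * u) :
    ∃ u : ℂ, (∃ j : ℕ, IsIntegral ℤ ((N : ℂ) ^ j * u)) ∧ x + y = (d : ℂ) * u := by
  obtain ⟨u, hu, rfl⟩ := hx
  obtain ⟨v, hv, rfl⟩ := hy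
  exact ⟨u + v, exists_isIntegral_pow_mul_add hu hv, by ring⟩

/-- `d·ℤ̄[1/N]` is a `ℤ̄[1/N]`-module: closed under multiplication by elements of `ℤ̄[1/N]` (on the left). [folklore] -/
theorem exists_eq_natCast_mul_mul_left {N d : ℕ} {t x : ℂ} (ht : ∃ j : ℕ, IsIntegral ℤ ((N : ℂ) ^ j * t))
    (hx : ∃ u : ℂ, (∃ j : ℕ, IsIntegral ℤ ((N : ℂ) ^ j * u)) ∧ x = (d : ℂ) * u) :
    ∃ u : ℂ, (∃ j : ℕ, IsIntegral ℤ ((N : ℂ) ^ j * u)) ∧ t * x = (d : ℂ) * u := by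
  obtain ⟨u, hu, rfl⟩ := hx
  exact ⟨t * u, exists_isIntegral_pow_mul_mul ht hu, by ring⟩

/-- `0 ∈ d·ℤ̄[1/N]`. [folklore] -/
theorem exists_eq_natCast_mul_zero {N d : ℕ} :
    ∃ u : ℂ, (∃ j : ℕ, IsIntegral ℤ ((N : ℂ) ^ j * u)) ∧ (0 : ℂ) = (d : ℂ) * u :=
  ⟨0, exists_isIntegral_pow_mul_zero, by simp⟩

/-- `d·ℤ̄[1/N]` is closed under negation. [folklore] -/
theorem exists_eq_natCast_mul_neg {N d : ℕ} {x : ℂ}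
    (hx : ∃ u : ℂ, (∃ j : ℕ, IsIntegral ℤ ((N : ℂ) ^ j * u)) ∧ x = (d : ℂ) * u) :
    ∃ u : ℂ, (∃ j : ℕ, IsIntegral ℤ ((N : ℂ) ^ j * u)) ∧ -x = (d : ℂ) * u := by
  obtain ⟨u, hu, rfl⟩ := hx
  exact ⟨-u, exists_isIntegral_pow_mul_neg hu, by ring⟩

/-- `d·ℤ̄[1/N]` is closed under subtraction. [folklore] -/
theorem exists_eq_natCast_mul_sub {N d : ℕ} {x y : ℂ}
    (hx : ∃ u : ℂ, (∃ j : ℕ, IsIntegral ℤ ((N : ℂ) ^ j * u)) ∧ x = (d : ℂ) * u)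
    (hy : ∃ u : ℂ, (∃ j : ℕ, IsIntegral ℤ ((N : ℂ) ^ j * u)) ∧ y = (d : ℂ) * u) :
    ∃ u : ℂ, (∃ j : ℕ, IsIntegral ℤ ((N : ℂ) ^ j * u)) ∧ x - y = (d : ℂ) * u := by
  rw [sub_eq_add_neg]
  exact exists_eq_natCast_mul_add hx (exists_eq_natCast_mul_neg hy)

/-- `d·ℤ̄[1/N]` is closed under finite sums. [folklore] -/
theorem exists_eq_natCast_mul_sum {N d : ℕ} {ι : Type*} (s : Finset ι) {g : ι → ℂ}
    (hg : ∀ i ∈ s, ∃ u : ℂ, (∃ j : ℕ, IsIntegral ℤ ((N : ℂ) ^ j * u)) ∧ g i = (d : ℂ) * u) :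
    ∃ u : ℂ, (∃ j : ℕ, IsIntegral ℤ ((N : ℂ) ^ j * u)) ∧ ∑ i ∈ s, g i = (d : ℂ) * u := by
  classical
  induction s using Finset.induction_on with
  | empty => simpa using (exists_eq_natCast_mul_zero (N := N) (d := d))
  | @insert a s ha ih =>
    rw [Finset.sum_insert ha]
    exact exists_eq_natCast_mul_add (hg a (Finset.mem_insert_self a s))
      (ih fun i hi => hg i (Finset.mem_insert_of_mem hi))

/-! ## §2 Power-series division by a unit of `ℤ̄[1/N]⟦q⟧`, and product closure -/

/-- **Division by a power series with unit constant term preserves `d·ℤ̄[1/N]`-coefficients.** If `A = T·B` in `ℂ⟦q⟧`, every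
coefficient of `A` lies in `d·ℤ̄[1/N]`, every coefficient of `T` lies in `ℤ̄[1/N]`, and `coeff 0 T` is a unit of `ℤ̄[1/N]`, then every
coefficient of `B` lies in `d·ℤ̄[1/N]` — strong induction on the Cauchy product
`coeff n A = coeff 0 T · coeff n B + Σ_{i ≥ 1, i + j = n} coeff i T · coeff j B`. [folklore] -/
theorem forall_coeff_of_eq_mul_of_unit {N d : ℕ} {A T B : PowerSeries ℂ} (h : A = T * B)
    (hA : ∀ n : ℕ, ∃ u : ℂ, (∃ j : ℕ, IsIntegral ℤ ((N : ℂ) ^ j * u)) ∧ coeff n A = (d : ℂ) * u)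
    (hT : ∀ n : ℕ, ∃ j : ℕ, IsIntegral ℤ ((N : ℂ) ^ j * coeff n T))
    (hT0 : ∃ v : ℂ, (∃ j : ℕ, IsIntegral ℤ ((N : ℂ) ^ j * v)) ∧ coeff 0 T * v = 1) :
    ∀ n : ℕ, ∃ u : ℂ, (∃ j : ℕ, IsIntegral ℤ ((N : ℂ) ^ j * u)) ∧ coeff n B = (d : ℂ) * u := by
  obtain ⟨v, hv, hTv⟩ := hT0
  intro n
  induction n using Nat.strong_induction_on with
  | _ n ih =>
    -- `coeff n A = Σ_{(i,j) ∈ antidiagonal n} coeff i T · coeff j B`, split off `(0, n)`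
    have hmem : ((0, n) : ℕ × ℕ) ∈ Finset.HasAntidiagonal.antidiagonal n := by simp
    have hsplit : coeff n A = coeff 0 T * coeff n B +
        ∑ x ∈ (Finset.HasAntidiagonal.antidiagonal n).erase (0, n), coeff x.1 T * coeff x.2 B := by
      rw [h, coeff_mul, ← Finset.add_sum_erase _ _ hmem]
    -- the remaining terms have `x.2 < n`, so the induction hypothesis applies
    have hrest : ∃ u : ℂ, (∃ j : ℕ, IsIntegral ℤ ((N : ℂ) ^ j * u)) ∧
        ∑ x ∈ (Finset.HasAntidiagonal.antidiagonal n).erase (0, n), coeff x.1 T * coeff x.2 B = (d : ℂ) * u := by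
      refine exists_eq_natCast_mul_sum _ fun x hx => ?_
      obtain ⟨hne, hx⟩ := Finset.mem_erase.mp hx
      rw [Finset.HasAntidiagonal.mem_antidiagonal] at hx
      have hx2 : x.2 < n := by
        rcases Nat.lt_or_ge x.2 n with hlt | hge
        · exact hlt
        · exfalso
          have h2 : x.2 = n := by omega
          have h1 : x.1 = 0 := by omega
          exact hne (Prod.ext h1 h2)
      exact exists_eq_natCast_mul_mul_left (hT x.1) (ih x.2 hx2)
    -- `coeff n B = v · (coeff n A − rest)`
    have hBn : coeff n B = v * (coeff n A - ∑ x ∈ (Finset.HasAntidiagonal.antidiagonal n).erase (0, n), coeff x.1 T * coeff x.2 B) := by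
      have : coeff n A - ∑ x ∈ (Finset.HasAntidiagonal.antidiagonal n).erase (0, n), coeff x.1 T * coeff x.2 B = coeff 0 T * coeff n B := by
        rw [hsplit]; ring
      rw [this, ← mul_assoc, mul_comm v, hTv, one_mul]
    rw [hBn]
    exact exists_eq_natCast_mul_mul_left hv (exists_eq_natCast_mul_sub (hA n) hrest)

/-- **Product closure** (the INPUT side of the transport: «cut form ≡ 0 (mod p)» ⟹ «vehicle ≡ 0 (mod p)»): if every coefficient of `A`
lies in `d·ℤ̄[1/N]` and every coefficient of `T` in `ℤ̄[1/N]`, then every coefficient of `A·T` lies in `d·ℤ̄[1/N]`. [folklore] -/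
theorem forall_coeff_mul {N d : ℕ} {A T : PowerSeries ℂ}
    (hA : ∀ n : ℕ, ∃ u : ℂ, (∃ j : ℕ, IsIntegral ℤ ((N : ℂ) ^ j * u)) ∧ coeff n A = (d : ℂ) * u)
    (hT : ∀ n : ℕ, ∃ j : ℕ, IsIntegral ℤ ((N : ℂ) ^ j * coeff n T)) :
    ∀ n : ℕ, ∃ u : ℂ, (∃ j : ℕ, IsIntegral ℤ ((N : ℂ) ^ j * u)) ∧ coeff n (A * T) = (d : ℂ) * u := by
  intro n
  rw [coeff_mul]
  exact exists_eq_natCast_mul_sum _ fun x _ => by rw [mul_comm]; exact exists_eq_natCast_mul_mul_left (hT x.2) (hA x.1)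


/-! ## §3 NF-Q at EVERY coefficient of EVERY cusp -/

/-- **Katz's q-expansion principle read at every coefficient of every cusp (from the named fact NF-Q).** Let `f` be a modular form of
weight `k` on `Γ₁(L)`, `L ∣ N`, `3 ≤ N`, `d ∈ ℕ`. If every coefficient of its q-expansion at `∞` (parameter `e^{2πiz}`) lies in `d·ℤ̄[1/N]`,
then for every `γ ∈ SL₂(ℤ)` EVERY coefficient of the q-expansion of `f ∣_k γ` at `∞` (parameter `e^{2πiz/N}`) — the expansion of `f` at the
cusp `γ·∞` — lies in `d·ℤ̄[1/N]`. ((γ) `exists_isIntegral_valueAtInfty_slash_of_qExpansion_one` was the constant term.) CONDITIONAL on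
`Katz1973_qExpansionPrinciple_allCusps` (hypothesis). [cite: Katz1973, §1.6 Cor. 1.6.2, §1.2, §1.7] -/
theorem exists_isIntegral_qExpansion_slash_coeff
    (hQ : Literature.NumberTheory.ModularForms.Katz1973_qExpansionPrinciple_allCusps)
    {L N : ℕ} (hLN : L ∣ N) (hN : 3 ≤ N) {k : ℤ} (f : ModularForm (Gamma1 L) k) (d : ℕ)
    (hcoef : ∀ n : ℕ, ∃ y : ℂ, (∃ j : ℕ, IsIntegral ℤ ((N : ℂ) ^ j * y)) ∧ (qExpansion 1 ⇑f).coeff n = (d : ℂ) * y)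
    (γ : SL(2, ℤ)) (n : ℕ) :
    ∃ y : ℂ, (∃ j : ℕ, IsIntegral ℤ ((N : ℂ) ^ j * y)) ∧ (qExpansion N (⇑f ∣[k] γ)).coeff n = (d : ℂ) * y := by
  have hN0 : 0 < N := by omega
  haveI : NeZero N := ⟨hN0.ne'⟩
  haveI : NeZero L := ⟨by rintro rfl; rw [zero_dvd_iff] at hLN; omega⟩
  obtain ⟨g, hg⟩ := exists_modularForm_gamma_coe_eq_of_gamma1 f hLN
  have h1 : (1 : ℝ) ∈ (Gamma1 L : Subgroup (GL (Fin 2) ℝ)).strictPeriods := by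
    rw [strictPeriods_Gamma1]; exact AddSubgroup.mem_zmultiples _
  have hper : Periodic (⇑f ∘ ofComplex) 1 := SlashInvariantFormClass.periodic_comp_ofComplex f h1
  have hbdd : IsBoundedAtImInfty ⇑f := ModularFormClass.bdd_at_infty f
  -- the hypothesis of NF-Q for `g` (q-expansion in the parameter `e^{2πiz/N}`)
  have hcoefN : ∀ n : ℕ, ∃ y : ℂ, (∃ j : ℕ, IsIntegral ℤ ((N : ℂ) ^ j * y)) ∧
      (qExpansion N ⇑g).coeff n = (d : ℂ) * y := by
    intro n
    rw [hg, qExpansion_natCast_coeff_eq_ite hN0 hper f.holo' hbdd n]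
    by_cases hn : N ∣ n
    · rw [if_pos hn]; exact hcoef (n / N)
    · rw [if_neg hn]; exact ⟨0, ⟨0, by simpa using isIntegral_zero⟩, by simp⟩
  have h := hQ N hN k g d hcoefN γ n
  rwa [hg] at h

/-! ## §4 The transport through a factorisation `F ∣_k γ = Θ · B` -/

/-- **THE NF-Q TRANSPORT THROUGH A θ-TYPE FACTOR.** Let `f` be a modular form of weight `k` on `Γ₁(L)`, `L ∣ N`, `3 ≤ N`, with every
coefficient of `qExpansion 1 f` in `d·ℤ̄[1/N]`, and `γ ∈ SL₂(ℤ)`. Suppose `f ∣_k γ = Θ · B` pointwise on `ℍ`, where `Θ, B : ℍ → ℂ` have cusp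
functions (parameter `e^{2πiz/N}`) analytic at `0`, every coefficient of `qExpansion N Θ` lies in `ℤ̄[1/N]`, and `coeff 0 (qExpansion N Θ)` is a
unit of `ℤ̄[1/N]`. Then EVERY coefficient of `qExpansion N B` lies in `d·ℤ̄[1/N]` (§3 + Mathlib `qExpansion_mul` + the division §2). This
is the MOD-`p` COROLLARY of crux notes lead-g14 §2.1 in kernel currency: at the flipped cusp `γ∞·∞`, `Θ` = the theta power of the vehicle
(`coeff 0 = 1` up to a unit), `B` = the translate bracket whose frequencies `q·u` carry `(1/2q)(1 + σ q (−u/q))·a(qu)` (T3). CONDITIONAL on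
NF-Q (hypothesis). [cite: Katz1973, §1.6 Cor. 1.6.2] -/
theorem exists_isIntegral_qExpansion_coeff_of_slash_eq_mul
    (hQ : Literature.NumberTheory.ModularForms.Katz1973_qExpansionPrinciple_allCusps)
    {L N : ℕ} (hLN : L ∣ N) (hN : 3 ≤ N) {k : ℤ} (f : ModularForm (Gamma1 L) k) (d : ℕ)
    (hcoef : ∀ n : ℕ, ∃ y : ℂ, (∃ j : ℕ, IsIntegral ℤ ((N : ℂ) ^ j * y)) ∧ (qExpansion 1 ⇑f).coeff n = (d : ℂ) * y)
    (γ : SL(2, ℤ)) {Θ B : ℍ → ℂ} (hfac : ∀ z : ℍ, (⇑f ∣[k] γ) z = Θ z * B z)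
    (hΘ : AnalyticAt ℂ (cuspFunction N Θ) 0) (hB : AnalyticAt ℂ (cuspFunction N B) 0)
    (hΘint : ∀ n : ℕ, ∃ j : ℕ, IsIntegral ℤ ((N : ℂ) ^ j * (qExpansion N Θ).coeff n))
    (hΘ0 : ∃ v : ℂ, (∃ j : ℕ, IsIntegral ℤ ((N : ℂ) ^ j * v)) ∧ (qExpansion N Θ).coeff 0 * v = 1) (n : ℕ) :
    ∃ y : ℂ, (∃ j : ℕ, IsIntegral ℤ ((N : ℂ) ^ j * y)) ∧ (qExpansion N B).coeff n = (d : ℂ) * y := by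
  have hfun : (⇑f ∣[k] γ) = Θ * B := funext fun z => by rw [hfac z]; rfl
  have hprod : qExpansion N (⇑f ∣[k] γ) = qExpansion N Θ * qExpansion N B := by
    rw [hfun]; exact qExpansion_mul hΘ hB
  exact forall_coeff_of_eq_mul_of_unit hprod (exists_isIntegral_qExpansion_slash_coeff hQ hLN hN f d hcoef γ) hΘint hΘ0 n

/-- **Feeding the `Θ`-hypotheses from the `1`-periodic expansion (integrality).** If `Θ : ℍ → ℂ` is `1`-periodic, holomorphic and bounded
at `i∞`, and every coefficient of `qExpansion 1 Θ` lies in `ℤ̄[1/N]` (e.g. is a natural number: `θ(z)^p`, `θ(R²z)^p`), then for `N ≥ 1` every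
coefficient of `qExpansion N Θ` lies in `ℤ̄[1/N]` (dilation, (γ) `qExpansion_natCast_coeff_eq_ite`). [cite: DiamondShurman2005, §1.1] -/
theorem forall_isIntegral_qExpansion_natCast_coeff {Θ : ℍ → ℂ} {N : ℕ} (hN : 0 < N) (hper : Periodic (Θ ∘ ofComplex) 1)
    (hhol : MDifferentiable 𝓘(ℂ) 𝓘(ℂ) Θ) (hbdd : IsBoundedAtImInfty Θ)
    (hint : ∀ n : ℕ, ∃ j : ℕ, IsIntegral ℤ ((N : ℂ) ^ j * (qExpansion 1 Θ).coeff n)) (n : ℕ) :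
    ∃ j : ℕ, IsIntegral ℤ ((N : ℂ) ^ j * (qExpansion N Θ).coeff n) := by
  rw [qExpansion_natCast_coeff_eq_ite hN hper hhol hbdd n]
  by_cases hn : N ∣ n
  · rw [if_pos hn]; exact hint (n / N)
  · rw [if_neg hn]; exact exists_isIntegral_pow_mul_zero

/-- **Feeding the `Θ`-hypotheses from the `1`-periodic expansion (constant term).** For `Θ` `1`-periodic, holomorphic, bounded at `i∞` and
`N ≥ 1`: `coeff 0 (qExpansion N Θ) = coeff 0 (qExpansion 1 Θ)`. [cite: DiamondShurman2005, §1.1] -/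
theorem qExpansion_natCast_coeff_zero {Θ : ℍ → ℂ} {N : ℕ} (hN : 0 < N) (hper : Periodic (Θ ∘ ofComplex) 1)
    (hhol : MDifferentiable 𝓘(ℂ) 𝓘(ℂ) Θ) (hbdd : IsBoundedAtImInfty Θ) :
    (qExpansion N Θ).coeff 0 = (qExpansion 1 Θ).coeff 0 := by
  rw [qExpansion_natCast_coeff_eq_ite hN hper hhol hbdd 0, if_pos (dvd_zero N), Nat.zero_div]

/-- The cusp function of a `1`-periodic holomorphic function bounded at `i∞` is analytic at `0` in the parameter `e^{2πiz/N}`, `N ≥ 1`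
(the analyticity hypothesis of §4 for such `Θ`). [cite: DiamondShurman2005, §1.1] -/
theorem analyticAt_cuspFunction_natCast {Θ : ℍ → ℂ} {N : ℕ} (hN : 0 < N) (hper : Periodic (Θ ∘ ofComplex) 1)
    (hhol : MDifferentiable 𝓘(ℂ) 𝓘(ℂ) Θ) (hbdd : IsBoundedAtImInfty Θ) : AnalyticAt ℂ (cuspFunction N Θ) 0 := by
  have hN' : (0 : ℝ) < N := by exact_mod_cast hN
  have hperN : Periodic (Θ ∘ ofComplex) (N : ℝ) := by simpa using hper.nat_mul N
  exact analyticAt_cuspFunction_zero hN' hperN hhol hbdd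

/-- The same for an `N`-periodic holomorphic function bounded at `i∞` (e.g. the bracket `B`, or `F ∣_k γ` itself). [cite: DiamondShurman2005, §1.1] -/
theorem analyticAt_cuspFunction_natCast_of_periodic {B : ℍ → ℂ} {N : ℕ} (hN : 0 < N) (hper : Periodic (B ∘ ofComplex) (N : ℝ))
    (hhol : MDifferentiable 𝓘(ℂ) 𝓘(ℂ) B) (hbdd : IsBoundedAtImInfty B) : AnalyticAt ℂ (cuspFunction N B) 0 :=
  analyticAt_cuspFunction_zero (by exact_mod_cast hN) hper hhol hbdd

/-! ## §5 The linear integrality transfer and its mod-`p` reading -/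

/-- **Integrality transfer, linear shape with a unit.** `p ∤ N` prime; `x : ℚ` (a Cohen number), `c : ℤ` with `p ∤ c` (the weight
`(1 − q*)/…`), `u` a unit of `ℤ̄[1/N]` with inverse `v` (powers of `q`, roots of unity), `y ∈ ℤ̄[1/N]`: if `x·c·u = p^e·y` in `ℂ` then
`x = 0 ∨ e ≤ v_p(x)` ((γ) `le_padicValRat_of_eq_pow_mul` applied to the rational `x·c`). [folklore] -/
theorem le_padicValRat_of_mul_mul_eq_pow_mul {p N : ℕ} [hp : Fact p.Prime] (hpN : ¬ p ∣ N) {x : ℚ} {c : ℤ} (hc : ¬ (p : ℤ) ∣ c)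
    {u v y : ℂ} (huv : u * v = 1) (hv : ∃ j : ℕ, IsIntegral ℤ ((N : ℂ) ^ j * v)) (hy : ∃ j : ℕ, IsIntegral ℤ ((N : ℂ) ^ j * y))
    {e : ℕ} (hx : (x : ℂ) * (c : ℂ) * u = (p : ℂ) ^ e * y) : x = 0 ∨ (e : ℤ) ≤ padicValRat p x := by
  rcases eq_or_ne x 0 with rfl | hx0
  · exact Or.inl rfl
  right
  have hc0 : c ≠ 0 := by rintro rfl; exact hc (dvd_zero _)
  have hxc : (((x * c : ℚ)) : ℂ) = (p : ℂ) ^ e * (y * v) := by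
    have : (((x * c : ℚ)) : ℂ) = (x : ℂ) * (c : ℂ) * u * v := by push_cast; rw [mul_assoc ((x : ℂ) * c), huv, mul_one]
    rw [this, hx]; ring
  rcases le_padicValRat_of_eq_pow_mul hpN (exists_isIntegral_pow_mul_mul hy hv) hxc with h | h
  · exact absurd h (mul_ne_zero hx0 (by exact_mod_cast hc0))
  · rw [padicValRat.mul hx0 (by exact_mod_cast hc0), padicValRat.of_int,
      padicValInt.eq_zero_of_not_dvd hc] at h
    simpa using h

/-- **The mod-`p` reading** (the last arrow, via (γ) §6): under the hypotheses of `le_padicValRat_of_mul_mul_eq_pow_mul` with `e = 1`,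
every `z ∈ ℤ_p` with `↑z = ↑x` in `ℚ_p` is killed by any ring map `ι : ℤ_p → 𝔽` into a field of characteristic `p`. [folklore] -/
theorem forall_map_eq_zero_of_mul_mul_eq {p N : ℕ} [hp : Fact p.Prime] (hpN : ¬ p ∣ N) {𝔽 : Type*} [Field 𝔽] [CharP 𝔽 p]
    (ι : ℤ_[p] →+* 𝔽) {x : ℚ} {c : ℤ} (hc : ¬ (p : ℤ) ∣ c) {u v y : ℂ} (huv : u * v = 1)
    (hv : ∃ j : ℕ, IsIntegral ℤ ((N : ℂ) ^ j * v)) (hy : ∃ j : ℕ, IsIntegral ℤ ((N : ℂ) ^ j * y))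
    (hx : (x : ℂ) * (c : ℂ) * u = (p : ℂ) * y) :
    ∀ z : ℤ_[p], (z : ℚ_[p]) = ((x : ℚ) : ℚ_[p]) → ι z = 0 := by
  refine forall_map_eq_zero_of_padicValRat ι ?_
  have h := le_padicValRat_of_mul_mul_eq_pow_mul (e := 1) hpN hc huv hv hy (by rw [pow_one]; exact hx)
  simpa using h


/-! ## §6 The `Θ`-hypotheses of §4 DISCHARGED for the theta powers `θ(Q²z)^p`, and the packaged transport -/

/-- **The theta power `θ(Q²·)^p` satisfies the `Θ`-hypotheses of §4** at every parameter `N ≥ 1`: its cusp function is analytic at `0`,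
every coefficient of `qExpansion N (θ(Q²·)^p)` is a natural number (hence in `ℤ̄[1/N]`), and the constant term is `1`
(w8 g7's `HalfIntegralBridge.exists_powerSeries_nat_qExpansion_thetaMul` / `qExpansion_pow_of_mem`, dilated by (γ) §2).
[cite: Tunnell1983Congruent, p. 326] -/
theorem thetaMul_sq_pow_hypotheses {Q : ℕ} (hQ : 0 < Q) (p : ℕ) {N : ℕ} (hN : 0 < N) :
    AnalyticAt ℂ (cuspFunction N (Literature.NumberTheory.EllipticCurves.Tunnell1983.thetaMul (Q ^ 2) ^ p)) 0 ∧
    (∀ n : ℕ, ∃ j : ℕ, IsIntegral ℤ ((N : ℂ) ^ j *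
      (qExpansion N (Literature.NumberTheory.EllipticCurves.Tunnell1983.thetaMul (Q ^ 2) ^ p)).coeff n)) ∧
    (qExpansion N (Literature.NumberTheory.EllipticCurves.Tunnell1983.thetaMul (Q ^ 2) ^ p)).coeff 0 = 1 := by
  have hmem := HalfIntegralBridge.thetaMul_sq_pow_mem_halfIntModularForms hQ p
  have hhol := hmem.1
  have hper := hmem.2.1.periodic_comp_ofComplex hmem.1
  have hbdd := Literature.NumberTheory.EllipticCurves.ModularForms.isBoundedAtImInfty_of_mem_halfIntModularForms hmem
  obtain ⟨Θ, hΘ, h0, -⟩ := HalfIntegralBridge.exists_powerSeries_nat_qExpansion_thetaMul (pow_pos hQ 2)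
  have hexp : qExpansion 1 (Literature.NumberTheory.EllipticCurves.Tunnell1983.thetaMul (Q ^ 2) ^ p) =
      (Θ ^ p).map (Nat.castRingHom ℂ) := by
    rw [HalfIntegralBridge.qExpansion_pow_of_mem (HalfIntegralBridge.thetaMul_sq_mem_halfIntModularForms hQ) p, hΘ, map_pow]
  refine ⟨analyticAt_cuspFunction_natCast hN hper hhol hbdd, ?_, ?_⟩
  · refine forall_isIntegral_qExpansion_natCast_coeff hN hper hhol hbdd fun n => ?_
    rw [hexp, PowerSeries.coeff_map]
    exact exists_isIntegral_pow_mul_natCast _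
  · rw [qExpansion_natCast_coeff_zero hN hper hhol hbdd, hexp, PowerSeries.coeff_map, PowerSeries.coeff_zero_eq_constantCoeff_apply,
      map_pow, ← PowerSeries.coeff_zero_eq_constantCoeff_apply, h0]
    simp

/-- **T4 PACKAGED FOR A THETA-POWER FACTOR** (the shape the flipped-cusp vehicle meets: `F = (P_σ f)·θ(Q²·)^p`, and at `γ∞ = (a b; M q⁴)`
T3 gives `F ∣_K γ∞ = θ(Q²·)^p · B` with `B` the translate bracket). NF-Q, `F : ModularForm (Gamma1 L) k`, `L ∣ N`, `3 ≤ N`, every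
coefficient of `qExpansion 1 F` in `d·ℤ̄[1/N]`, `γ ∈ SL₂(ℤ)`, `F ∣_k γ = θ(Q²·)^p · B` pointwise with `cuspFunction N B` analytic at `0`
⟹ EVERY coefficient of `qExpansion N B` lies in `d·ℤ̄[1/N]`. [cite: Katz1973, §1.6 Cor. 1.6.2] -/
theorem exists_isIntegral_qExpansion_coeff_of_slash_eq_thetaMul_pow_mul
    (hKatz : Literature.NumberTheory.ModularForms.Katz1973_qExpansionPrinciple_allCusps)
    {L N : ℕ} (hLN : L ∣ N) (hN : 3 ≤ N) {k : ℤ} (f : ModularForm (Gamma1 L) k) (d : ℕ)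
    (hcoef : ∀ n : ℕ, ∃ y : ℂ, (∃ j : ℕ, IsIntegral ℤ ((N : ℂ) ^ j * y)) ∧ (qExpansion 1 ⇑f).coeff n = (d : ℂ) * y)
    (γ : SL(2, ℤ)) {Q : ℕ} (hQ : 0 < Q) (p : ℕ) {B : ℍ → ℂ}
    (hfac : ∀ z : ℍ, (⇑f ∣[k] γ) z = Literature.NumberTheory.EllipticCurves.Tunnell1983.thetaMul (Q ^ 2) z ^ p * B z)
    (hB : AnalyticAt ℂ (cuspFunction N B) 0) (n : ℕ) :
    ∃ y : ℂ, (∃ j : ℕ, IsIntegral ℤ ((N : ℂ) ^ j * y)) ∧ (qExpansion N B).coeff n = (d : ℂ) * y := by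
  have hN0 : 0 < N := by omega
  obtain ⟨hΘ, hΘint, hΘ0⟩ := thetaMul_sq_pow_hypotheses hQ p hN0
  refine exists_isIntegral_qExpansion_coeff_of_slash_eq_mul hKatz hLN hN f d hcoef γ (Θ := _ ^ p) (fun z => ?_) hΘ hB hΘint
    ⟨1, ⟨0, by simpa using isIntegral_one⟩, by rw [hΘ0, mul_one]⟩ n
  rw [hfac z]; rfl

end Summit.BirchSwinnertonDyer.BirchSwinnertonDyer.Theorems.PrintCFram.FlipRung

end
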